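import Summits.QuantumFields.YangMills.Theorems.SmallCircleAnchorAnchorGapStubDebyeScreening25

/-!
# Crux `AnchorGap` (stmt-QuantumFields-11141), line `registered` — the leg kernel bound (B3 template under stub X₀)

The `ℓ¹` mass `Λ₁` of the leg kernel `C_s D C_s` required by `gaussian_decoupling_step_bound`
(`…StubDebyeScreening25`) is controlled by the entrywise `ℓ¹` norm of the coupling `D` (for the
Debye–Hückel matrix: `2k g⁻²` per bond crossing the decoupled interface) times a column bound and a
row bound of the covariance (`torus_ell1_of_decay` with `weightedDhMatrix_inv_decay`, uniformly in
the volume and in the interpolation parameter):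

* `ell1_mul_mul_le` — `Σ_{a,b} |(C D C')_{ab}| ≤ (Σ_{p,q} |D_{pq}|) · (sup_p Σ_a |C_{ap}|) · (sup_q Σ_b |C'_{qb}|)`.
-/

set_option autoImplicit false

noncomputable section

namespace Summit.QuantumFields.YangMills.Theorems.AnchorGap

open Finset Matrix

/-- **`ℓ¹` bound for a sandwiched kernel.** For matrices `C, D, C'` on a finite index set with
column sums `Σ_a |C_{ap}| ≤ R₁` and row sums `Σ_b |C'_{qb}| ≤ R₂`:
`Σ_{a,b} |(C D C')_{ab}| ≤ (Σ_{p,q} |D_{pq}|) R₁ R₂` — legs times couplings. [folklore] -/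
theorem ell1_mul_mul_le :
    ∀ (ι : Type) [Fintype ι] (C D C' : Matrix ι ι ℝ) (R₁ R₂ : ℝ), (∀ p : ι, ∑ a : ι, |C a p| ≤ R₁) → (∀ q : ι, ∑ b : ι, |C' q b| ≤ R₂) → ∑ a : ι, ∑ b : ι, |(C * D * C') a b| ≤ (∑ p : ι, ∑ q : ι, |D p q|) * R₁ * R₂ := by
  intro ι _ C D C' R₁ R₂ hC hC'
  have hR₁ : ∀ p, 0 ≤ R₁ := fun p => (Finset.sum_nonneg fun a _ => abs_nonneg (C a p)).trans (hC p)
  -- entrywise expansion `(C D C')_{ab} = Σ_p Σ_q C_{ap} D_{pq} C'_{qb}`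
  have hexp : ∀ a b : ι, (C * D * C') a b = ∑ p, ∑ q, C a p * D p q * C' q b := by
    intro a b
    rw [Matrix.mul_apply]
    simp_rw [Matrix.mul_apply, Finset.sum_mul]
    rw [Finset.sum_comm]
  have hab : ∀ a b : ι, |(C * D * C') a b| ≤ ∑ p, ∑ q, |C a p| * |D p q| * |C' q b| := by
    intro a b
    rw [hexp]
    refine (Finset.abs_sum_le_sum_abs _ _).trans (Finset.sum_le_sum fun p _ => ?_)
    refine (Finset.abs_sum_le_sum_abs _ _).trans (Finset.sum_le_sum fun q _ => ?_)
    rw [abs_mul, abs_mul]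
  calc ∑ a, ∑ b, |(C * D * C') a b|
      ≤ ∑ a, ∑ b, ∑ p, ∑ q, |C a p| * |D p q| * |C' q b| :=
        Finset.sum_le_sum fun a _ => Finset.sum_le_sum fun b _ => hab a b
    _ = ∑ p, ∑ q, |D p q| * ((∑ a, |C a p|) * ∑ b, |C' q b|) := by
        -- reorder: `Σ_a Σ_b Σ_p Σ_q → Σ_p Σ_q Σ_a Σ_b`
        calc ∑ a, ∑ b, ∑ p, ∑ q, |C a p| * |D p q| * |C' q b|
            = ∑ a, ∑ p, ∑ b, ∑ q, |C a p| * |D p q| * |C' q b| :=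
              Finset.sum_congr rfl fun a _ => Finset.sum_comm
          _ = ∑ p, ∑ a, ∑ b, ∑ q, |C a p| * |D p q| * |C' q b| := Finset.sum_comm
          _ = ∑ p, ∑ a, ∑ q, ∑ b, |C a p| * |D p q| * |C' q b| :=
              Finset.sum_congr rfl fun p _ => Finset.sum_congr rfl fun a _ => Finset.sum_comm
          _ = ∑ p, ∑ q, ∑ a, ∑ b, |C a p| * |D p q| * |C' q b| :=
              Finset.sum_congr rfl fun p _ => Finset.sum_comm
          _ = ∑ p, ∑ q, |D p q| * ((∑ a, |C a p|) * ∑ b, |C' q b|) := by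
              refine Finset.sum_congr rfl fun p _ => Finset.sum_congr rfl fun q _ => ?_
              rw [Finset.sum_mul_sum, Finset.mul_sum]
              refine Finset.sum_congr rfl fun a _ => ?_
              rw [Finset.mul_sum]
              exact Finset.sum_congr rfl fun b _ => by ring
    _ ≤ ∑ p, ∑ q, |D p q| * (R₁ * R₂) := by
        refine Finset.sum_le_sum fun p _ => Finset.sum_le_sum fun q _ => ?_
        refine mul_le_mul_of_nonneg_left ?_ (abs_nonneg _)
        exact mul_le_mul (hC p) (hC' q) (Finset.sum_nonneg fun b _ => abs_nonneg _) (hR₁ p)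
    _ = (∑ p, ∑ q, |D p q|) * R₁ * R₂ := by
        rw [Finset.sum_mul, Finset.sum_mul]
        refine Finset.sum_congr rfl fun p _ => ?_
        rw [Finset.sum_mul, Finset.sum_mul]
        exact Finset.sum_congr rfl fun q _ => by ring

end Summit.QuantumFields.YangMills.Theorems.AnchorGap

end
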